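import Literature.NumberTheory.GaloisRepresentations.EisensteinSexticRamificationQuadratic
import HarnessLib

/-!
# The Größencharakter of `y² = x³ + k` is ramified above the primes of `2k` away from `3`, III: the prime `2`, and the assembly over all
# primes `p ≠ 3` of `2k` (Ireland–Rosen Ch. 18 §7; Silverman *ATAEC* II Thm. 9.2 (b), Thm. 10.5)

Topic `Literature/NumberTheory/GaloisRepresentations`, namespace `Literature.NumberTheory.GaloisRepresentations.EisensteinSextic` (sequel of
`EisensteinSexticRamificationQuadratic`; cell `bsd-wall`, seat bed-w3 g17, last part of «FILE C» of the Deuring row `j = 0`).  THEOREMS only,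
unconditional.

* §10 `not_isUnramifiedAt_psi_two_of_seed` (the engine at `p = 2` when `3 ∣ ord₂(4k)`: `N𝔮 ≡ N(g) (mod 2^N)`, `N𝔮 ≡ 1 (mod 9m)`, so
  `ψ̃((ϖ))/e(ϖ) = (k/N𝔮)` is a Jacobi symbol at a controlled odd `n`), `norm_seeds_two` (`N(4 + ω) = 13`, `N(1 + 2ω) = 3`),
  ★★ `not_isUnramifiedAt_psi_two_of_ord_eq_one` (`2 ∥ k`: `N𝔮 ≡ 5 (mod 8)`, `(2/N𝔮) = −1`), ★★ `not_isUnramifiedAt_psi_two_of_eq_sixteen_mul`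
  (`k = 16u`, `u ≡ 3 (mod 4)`: `N𝔮 ≡ 3 (mod 4)`, `(u/N𝔮) = −1` by Jacobi reciprocity);
* §11 ★★★ `not_isUnramifiedAt_heckeOfGross_psi_of_ne_three` — **for `k ≠ 0` sixth-power-free, every prime `p ≠ 3` and every place
  `𝔭_w ∋ p` with `𝔭_w ∣ 36k`, except `p = 2` on the good-reduction class `k ∈ 16(1 + 4ℤ)`, the Hecke character `heckeOfGross ψ` is ramified at
  `𝔭_w`** (dispatch on `ord_p k ∈ {0,…,5}`).  Together with bed-w1's `not_isUnramifiedAt_heckeOfGross_psi_three` (the prime `λ ∣ 3`) this is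
  clause (iii) of Deuring's theorem for the sextic twists at the bad primes: the conductor of `ψ` contains every bad prime of `E^k`.

Nothing about BSD is proved here; no modularity is used.

## References
* K. Ireland, M. Rosen, *A Classical Introduction to Modern Number Theory*, 2nd ed., GTM 84 (1990), Ch. 5 §2 (Jacobi symbol, reciprocity),
  Ch. 9 §1 (`ℤ[ω]`), §3 Theorem 1 (cubic reciprocity) with §4 (proof), Ch. 18 §3 Theorem 4, §6 Theorem 7 (proof: «`χ` is a Hecke character
  … with conductor dividing `12D`»), §7 («if `P ∣ 6D` define `χ(P) = 0`», Theorem 4′). [IrelandRosen1990]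
* J. Neukirch, *Algebraic Number Theory* (1999), Ch. I §3, Ch. VI §1 (1.7)–(1.9), Ch. VII §6 (6.13)–(6.14), §13 (13.2). [NeukirchANT1999]
* E. Landau, *Über Ideale und Primideale in Idealklassen*, Math. Z. 2 (1918), §1. [Landau1918Idealklassen]
* J. H. Silverman, *Advanced Topics in the Arithmetic of Elliptic Curves* (1994), II Thm. 9.2, Thm. 10.5. [SilvermanATAEC1994]

## Mathlib / tree search
Tree: `EisensteinSexticRamificationEngine` (§§7–8), `EisensteinSexticRamificationQuadratic` (§9), `smul_zeta`, `smul_intCast`,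
`sq_add_self_add_one_eq_zero`.  Mathlib: `jacobiSym.at_two`, `ZMod.χ₈_nat_eq_if_mod_eight`, `jacobiSym.sq_one'`, `jacobiSym.neg`,
`ZMod.χ₄_nat_three_mod_four`, `jacobiSym.quadratic_reciprocity_three_mod_four`, `jacobiSym.quadratic_reciprocity_one_mod_four`, `jacobiSym.mod_left`,
`Nat.modEq_and_modEq_iff_modEq_mul`, `Nat.coprime_two_left`, `Nat.exists_eq_pow_mul_and_not_dvd`, `interval_cases`.
-/

noncomputable section

open NumberField IsDedekindDomain IsDedekindDomain.HeightOneSpectrum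
open scoped NumberTheorySymbols ComplexConjugate Pointwise

namespace Literature.NumberTheory.GaloisRepresentations.EisensteinSextic

open Literature.NumberTheory.GaloisRepresentations
open Literature.NumberTheory.LFunctions (idealPow isCoprime_span_of_sub_mem RayClassRel CoprimeIdeal
  exists_rayClassRel_prime_absNorm_not_mem)
open Literature.NumberTheory.LFunctions.AbelianDensity (artinSymbol artinSymbol_asIdeal)
open Literature.NumberTheory.Automorphic (RingOfIntegers.coe_algEquiv_smul HeightOneSpectrum.smul_mem_smul_asIdeal_iff)

variable {K : Type} [Field K] [NumberField K]

section Two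

variable {ζ : 𝓞 K} (hζ : IsPrimitiveRoot ζ 3) [IsCyclotomicExtension {3} ℚ K]

/-! ### §10 The prime `2`: `ord₂ k = 1` (`(2/N𝔮) = −1`, `N𝔮 ≡ 5 (mod 8)`) and `k = 16u`, `u ≡ 3 (mod 4)` (`N𝔮 ≡ 3 (mod 4)`) -/

include hζ in
/-- The place above `2` of `ℚ(ω)` is `(2)` with `N = 4`; `ζ ∉ (2)` and `1 + 2ζ ∉ (2)`; norms `N(4 + ζ) = 13`, `N(1 + 2ζ) = 3`.
[cite: IrelandRosen1990, Ch. 9 §1 (`N(a + bω) = a² − ab + b²`)] -/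
theorem norm_seeds_two {c : K ≃ₐ[ℚ] K} (hc : c ≠ 1) :
    Ideal.absNorm (Ideal.span {(4 + ζ : 𝓞 K)}) = 13 ∧ Ideal.absNorm (Ideal.span {(1 + 2 * ζ : 𝓞 K)}) = 3 := by
  have hζ3 : ζ ^ 3 = 1 := hζ.pow_eq_one
  have hζ2 : ζ ^ 2 + ζ + 1 = 0 := sq_add_self_add_one_eq_zero hζ
  have hcζ : c • ζ = ζ ^ 2 := smul_zeta hζ hc
  have h4 : c • (4 : 𝓞 K) = 4 := by have := smul_intCast c 4; exact_mod_cast this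
  have h1 : c • (1 : 𝓞 K) = 1 := smul_one c
  have h2 : c • (2 : 𝓞 K) = 2 := by have := smul_intCast c 2; exact_mod_cast this
  constructor
  · have h := natCast_absNorm_span_eq_mul_smul hc (4 + ζ : 𝓞 K)
    rw [smul_add, h4, hcζ] at h
    have h13 : ((Ideal.absNorm (Ideal.span {(4 + ζ : 𝓞 K)}) : ℕ) : 𝓞 K) = ((13 : ℕ) : 𝓞 K) := by
      rw [h]; push_cast; linear_combination 4 * hζ2 + hζ3
    exact_mod_cast h13
  · have h := natCast_absNorm_span_eq_mul_smul hc (1 + 2 * ζ : 𝓞 K)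
    rw [smul_add, h1, smul_mul', h2, hcζ] at h
    have h3 : ((Ideal.absNorm (Ideal.span {(1 + 2 * ζ : 𝓞 K)}) : ℕ) : 𝓞 K) = ((3 : ℕ) : 𝓞 K) := by
      rw [h]; push_cast; linear_combination 2 * hζ2 + 4 * hζ3
    exact_mod_cast h3


include hζ in
/-- ★ **The engine at `p = 2`** when `3 ∣ ord₂(4k)` (cubic part unramified at `2`): for a seed `g ∉ (2)` and a power `2^N ∣ 36k`, the auxiliary
prime `𝔮 = (ϖ)` with `ϖ ≡ g (mod 2^{n_w})` has `N𝔮 ≡ N(g) (mod 2^N)`, `N𝔮 ≡ 1 (mod 9m)` (`4k = 2^v m`), and `ψ̃((ϖ))/e(ϖ) = (k/N𝔮)`; so if every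
such odd `n` has `(k/n) = −1`, `ψ` is ramified at `(2)`. [cite: IrelandRosen1990, Ch. 18 §7] [cite: SilvermanATAEC1994, II Thm. 10.5] -/
theorem not_isUnramifiedAt_psi_two_of_seed {k : ℤ} (hk : k ≠ 0) (w₀ : InfinitePlace K) {v : ℕ} {m : ℤ}
    (hkm : 4 * k = 2 ^ v * m) (hm2 : ¬ (2 : ℤ) ∣ m) (hv0 : v ≠ 0) (hv3 : 3 ∣ v)
    {w : HeightOneSpectrum (𝓞 K)} (h2w : (2 : 𝓞 K) ∈ w.asIdeal) (hw : modulus k ≤ w.asIdeal) {N : ℕ}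
    (hN𝔣 : (2 : ℤ) ^ N ∣ 36 * k) {g : 𝓞 K} (hg : g ∉ w.asIdeal)
    (hJ : ∀ n : ℕ, Odd n → n ≡ Ideal.absNorm (Ideal.span {g}) [MOD 2 ^ N] → n ≡ 1 [MOD (9 * m).natAbs] → J(k | n) = -1) :
    ¬ (heckeOfGross (modulus_ne_bot hk) (isGrossencharakter_psi_one_zero hζ hk w₀)).IsUnramifiedAt w := by
  haveI := Fact.mk Nat.prime_two
  have hp3 : (2 : ℕ) ≠ 3 := by norm_num
  have h2w' : ((2 : ℕ) : 𝓞 K) ∈ w.asIdeal := by exact_mod_cast h2w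
  have h3w : (3 : 𝓞 K) ∉ w.asIdeal := three_not_mem_of_natCast_mem h2w' (by norm_num)
  have h𝔣 : modulus (K := K) k ≠ ⊥ := modulus_ne_bot hk
  have he : modulusExp (modulus k) w ≠ 0 := (modulusExp_ne_zero_iff _ h𝔣 w).mpr hw
  have hkm' : 4 * k = ((2 : ℕ) : ℤ) ^ v * m := by exact_mod_cast hkm
  have hm2' : ¬ ((2 : ℕ) : ℤ) ∣ m := by exact_mod_cast hm2
  obtain ⟨J, g₀, ϖ, 𝔮, h𝔣J, hg₀1, hg₀g, hg₀cop, hϖ, hϖg₀, -, hϖcop, hϖg, hϖw, hcong, -⟩ := exists_auxPrime hk hw g hg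
  obtain ⟨hg₀9, hϖ9, hϖ3, hp𝔮⟩ := auxPrime_sub_one_mem Nat.prime_two hp3 hkm' hm2' hv0 h2w' h𝔣J hg₀1 hϖg₀ hϖ hϖcop
  have hN := fun hwp : w.residueCard = 2 => residueCard_mul_sub_sq_mem hζ hk hw Nat.prime_two hp3 h2w' hwp hϖ hϖg hcong
  have hcubic := cubicResidueSymbol_intCast_eq_pow hζ hp3 hkm' hϖ hϖ9 hp𝔮 h2w' hg hϖg hN
  have hg0 : Ideal.Quotient.mk w.asIdeal g ≠ 0 := fun h0 => hg (Ideal.Quotient.eq_zero_iff_mem.mp h0)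
  obtain ⟨t, rfl⟩ := hv3
  rw [pow_mul, (cubicResidueSymbol_spec hζ h3w hg0).1, one_pow] at hcubic
  have hϖ0 : ϖ ≠ 0 := fun h => 𝔮.ne_bot (by rw [← hϖ, h, Ideal.span_singleton_eq_bot])
  have hg₀0 : g₀ ≠ 0 := by
    rintro rfl
    exact hg (by have := hg₀g; rw [zero_sub] at this; exact (w.asIdeal.neg_mem_iff).mp (Ideal.pow_le_self he this))
  refine not_isUnramifiedAt_psi_of_prime hζ hk w₀ hw hϖ hϖw hϖcop hϖ3 hcong ?_
  rw [hcubic, show ((1 : 𝓞 K) : K) = 1 by norm_cast, map_one, mul_one, ← hϖ,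
    jacobiSym_absNorm_eq_of_sub_mem hϖ0 hg₀0 hϖg₀ hϖcop hg₀cop]
  -- `N(g₀) ≡ N(g) (mod 2^N)`: `𝔭_w^{n_w} ⊆ (2^N)`
  have hw2 : w.asIdeal = Ideal.span {(2 : 𝓞 K)} := by
    have := asIdeal_eq_span_of_mod_three_eq_two (K := K) Nat.prime_two (by norm_num) h2w'; exact_mod_cast this
  have hNle : N ≤ modulusExp (modulus k) w := by
    have hdvd : w.asIdeal ^ N ∣ modulus (K := K) k := by
      obtain ⟨t', ht'⟩ := hN𝔣
      refine ⟨Ideal.span {(t' : 𝓞 K)}, ?_⟩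
      rw [hw2, Ideal.span_singleton_pow, Ideal.span_singleton_mul_span_singleton, modulus, ht']; push_cast; rfl
    exact (Associates.prime_pow_dvd_iff_le (Associates.mk_ne_zero.mpr h𝔣) w.associates_irreducible).mp
      (by rw [← Associates.mk_pow, Associates.mk_le_mk_iff_dvd]; exact hdvd)
  have hmodN : Ideal.absNorm (Ideal.span {g₀}) ≡ Ideal.absNorm (Ideal.span {g}) [MOD 2 ^ N] := by
    apply absNorm_span_modEq
    have h := Ideal.pow_le_pow_right hNle hg₀g
    rw [hw2, Ideal.span_singleton_pow] at h
    exact_mod_cast h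
  have h1 := hJ _ (odd_absNorm_of_isCoprime_modulus hg₀0 hg₀cop) hmodN (absNorm_modEq_one_of_sub_one_mem hg₀9)
  rw [h1]; norm_num

include hζ in
/-- ★★ **Ramification at `(2)` when `2 ∥ k`**: seed `g = 4 + ω` (`N = 13 ≡ 5 (mod 8)`), `2³ ∣ 36k`; then `N𝔮 ≡ 5 (mod 8)` and
`N𝔮 ≡ 1 (mod 4|k/2|)`, so `(k/N𝔮) = (2/N𝔮)·(k/2 / N𝔮) = −1`. [cite: IrelandRosen1990, Ch. 18 §7; Ch. 5 §1 Prop. 5.1.3] -/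
theorem not_isUnramifiedAt_psi_two_of_ord_eq_one {k m' : ℤ} (hk : k ≠ 0) (w₀ : InfinitePlace K) (hkm : k = 2 * m')
    (hm2 : ¬ (2 : ℤ) ∣ m') {w : HeightOneSpectrum (𝓞 K)} (h2w : (2 : 𝓞 K) ∈ w.asIdeal) (hw : modulus k ≤ w.asIdeal) :
    ¬ (heckeOfGross (modulus_ne_bot hk) (isGrossencharakter_psi_one_zero hζ hk w₀)).IsUnramifiedAt w := by
  obtain ⟨c, hc⟩ := exists_algEquiv_ne_one (K := K)
  have hg : (4 + ζ : 𝓞 K) ∉ w.asIdeal := fun h => w.isPrime.ne_top (Ideal.eq_top_of_isUnit_mem _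
    (by have := w.asIdeal.sub_mem h (w.asIdeal.mul_mem_left 2 h2w); rwa [show (4 + ζ : 𝓞 K) - 2 * 2 = ζ by ring] at this)
    (hζ.isUnit (by norm_num)))
  refine not_isUnramifiedAt_psi_two_of_seed hζ hk w₀ (v := 3) (m := m') (by rw [hkm]; ring) hm2 (by norm_num) (dvd_refl 3)
    h2w hw (N := 3) ⟨9 * m', by rw [hkm]; ring⟩ hg fun n hn h8 h9 => ?_
  rw [(norm_seeds_two hζ hc).1] at h8
  have hn8 : n % 8 = 5 := h8
  have hm'odd : Odd m'.natAbs := Int.natAbs_odd.mpr (Int.not_even_iff_odd.mp (fun h => hm2 (even_iff_two_dvd.mp h)))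
  have hcop : Nat.Coprime 4 m'.natAbs := by
    have := (Nat.coprime_two_left.mpr hm'odd).pow_left 2; norm_num at this; exact this
  have h4m : n ≡ 1 [MOD 4 * m'.natAbs] :=
    (Nat.modEq_and_modEq_iff_modEq_mul hcop).mp ⟨by unfold Nat.ModEq; omega, h9.of_dvd ⟨9, by rw [Int.natAbs_mul]; norm_num; ring⟩⟩
  have hJm : J(m' | n) = 1 := by
    rw [jacobiSym.mod_right m' hn, h4m, ← jacobiSym.mod_right m' odd_one, jacobiSym.one_right]
  have hJ2 : J(2 | n) = -1 := by
    rw [jacobiSym.at_two hn, ZMod.χ₈_nat_eq_if_mod_eight]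
    have h2 : n % 2 = 1 := by omega
    simp [h2, hn8]
  rw [hkm, jacobiSym.mul_left, hJ2, hJm]; norm_num

include hζ in
/-- ★★ **Ramification at `(2)` when `k = 16u`, `u ≡ 3 (mod 4)`** (the class `u ≡ 1 (mod 4)` is the good-reduction class of `y² = x³ + 16u`):
seed `g = 1 + 2ω` (`N = 3`), `2² ∣ 36k`; then `N𝔮 ≡ 3 (mod 4)`, `N𝔮 ≡ 1 (mod |u|)`, so `(k/N𝔮) = (u/N𝔮) = −1` by Jacobi reciprocity.
[cite: IrelandRosen1990, Ch. 18 §7; Ch. 5 §2 Theorem 2] -/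
theorem not_isUnramifiedAt_psi_two_of_eq_sixteen_mul {k u : ℤ} (hk : k ≠ 0) (w₀ : InfinitePlace K) (hku : k = 16 * u)
    (hu : u % 4 = 3) {w : HeightOneSpectrum (𝓞 K)} (h2w : (2 : 𝓞 K) ∈ w.asIdeal) (hw : modulus k ≤ w.asIdeal) :
    ¬ (heckeOfGross (modulus_ne_bot hk) (isGrossencharakter_psi_one_zero hζ hk w₀)).IsUnramifiedAt w := by
  obtain ⟨c, hc⟩ := exists_algEquiv_ne_one (K := K)
  have hu2 : ¬ (2 : ℤ) ∣ u := fun h => by omega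
  have hg : (1 + 2 * ζ : 𝓞 K) ∉ w.asIdeal := fun h => w.isPrime.ne_top ((Ideal.eq_top_iff_one _).mpr
    (by have := w.asIdeal.sub_mem h (w.asIdeal.mul_mem_right ζ h2w); rwa [show (1 + 2 * ζ : 𝓞 K) - 2 * ζ = 1 by ring] at this))
  refine not_isUnramifiedAt_psi_two_of_seed hζ hk w₀ (v := 6) (m := u) (by rw [hku]; ring) hu2 (by norm_num) ⟨2, rfl⟩
    h2w hw (N := 2) ⟨9 * 16 * u, by rw [hku]; ring⟩ hg fun n hn h4 h9 => ?_
  rw [(norm_seeds_two hζ hc).2] at h4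
  have hn4 : n % 4 = 3 := h4
  have hu' : n ≡ 1 [MOD u.natAbs] := h9.of_dvd ⟨9, by rw [Int.natAbs_mul]; norm_num; ring⟩
  -- `(16u / n) = (u / n)`
  have h16 : J(16 | n) = 1 := by
    rw [show (16 : ℤ) = 4 ^ 2 by norm_num]
    apply jacobiSym.sq_one'
    rw [show (4 : ℤ) = ((4 : ℕ) : ℤ) by norm_num, Int.gcd_natCast_natCast]
    have := (Nat.coprime_two_left.mpr hn).pow_left 2; norm_num at this; exact this
  have hJ1 : J((u.natAbs : ℤ) | n) = if u.natAbs % 4 = 3 then -1 else 1 := by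
    have hn1 : J((n : ℤ) | u.natAbs) = 1 := by
      rw [jacobiSym.mod_left, show (n : ℤ) % (u.natAbs : ℤ) = 1 % (u.natAbs : ℤ) by exact_mod_cast hu', ← jacobiSym.mod_left,
        jacobiSym.one_left]
    split_ifs with h3
    · rw [jacobiSym.quadratic_reciprocity_three_mod_four h3 hn4, hn1]
    · have h1 : u.natAbs % 4 = 1 := by
        have hodd : u.natAbs % 2 = 1 := Nat.odd_iff.mp (Int.natAbs_odd.mpr (Int.not_even_iff_odd.mp
          (fun h => hu2 (even_iff_two_dvd.mp h))))
        omega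
      rw [jacobiSym.quadratic_reciprocity_one_mod_four h1 hn, hn1]
  rw [hku, jacobiSym.mul_left, h16, one_mul]
  rcases Int.natAbs_eq u with hu_eq | hu_eq
  · rw [hu_eq, hJ1, if_pos (by omega)]
  · rw [hu_eq, jacobiSym.neg _ hn, ZMod.χ₄_nat_three_mod_four hn4, hJ1, if_neg (by omega)]; norm_num


/-! ### §11 Assembly over all primes of `2k` away from `3` -/

omit [NumberField K] [IsCyclotomicExtension {3} ℚ K] in
/-- `k = p^s · k₁` with `p ∤ k₁`, for `k ≠ 0` (`ord_p k`). [cite: IrelandRosen1990, Ch. 18 §7 (reduction to `D` sixth-power-free: `ord_p D ≤ 5`)] -/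
theorem int_exists_eq_pow_mul_not_dvd {k : ℤ} (hk : k ≠ 0) {p : ℕ} (hp : p.Prime) :
    ∃ (s : ℕ) (k₁ : ℤ), k = (p : ℤ) ^ s * k₁ ∧ ¬ (p : ℤ) ∣ k₁ := by
  obtain ⟨e, n', hn', hkn⟩ := Nat.exists_eq_pow_mul_and_not_dvd (Int.natAbs_ne_zero.mpr hk) p hp.ne_one
  have hn'' : ¬ (p : ℤ) ∣ (n' : ℤ) := by exact_mod_cast hn'
  rcases Int.natAbs_eq k with h | h
  · refine ⟨e, n', ?_, hn''⟩
    conv_lhs => rw [h, hkn]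
    push_cast; ring
  · refine ⟨e, -n', ?_, by rwa [dvd_neg]⟩
    conv_lhs => rw [h, hkn]
    push_cast; ring

omit [NumberField K] [IsCyclotomicExtension {3} ℚ K] in
/-- An odd prime not dividing `k₁` does not divide `4k₁`. [cite: IrelandRosen1990, Ch. 18 §7 (the primes of `4D`)] -/
theorem not_dvd_four_mul {p : ℕ} (hp : p.Prime) (hp2 : p ≠ 2) {k₁ : ℤ} (hpk₁ : ¬ (p : ℤ) ∣ k₁) : ¬ (p : ℤ) ∣ 4 * k₁ := by
  have hpZ : Prime (p : ℤ) := Nat.prime_iff_prime_int.mp hp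
  intro h
  rcases hpZ.dvd_or_dvd h with h4 | h4
  · have h2 : (p : ℤ) ∣ 2 := hpZ.dvd_of_dvd_pow (n := 2) (by norm_num; exact h4)
    exact hp2 ((Nat.prime_dvd_prime_iff_eq hp Nat.prime_two).mp (by exact_mod_cast h2))
  · exact hpk₁ h4

include hζ in
/-- ★★★ **The Größencharakter `ψ` of `y² = x³ + k` is RAMIFIED above every prime `p ≠ 3` of `2k`** — except, for `p = 2`, on the good-reduction
class `k ∈ 16(1 + 4ℤ)` — for `k ≠ 0` sixth-power-free: `𝔭_w ∣ 36k`, `𝔭_w ∋ p ≠ 3` ⇒ `heckeOfGross ψ` is ramified at `𝔭_w`.  Dispatch on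
`s = ord_p k ∈ {0,…,5}`: `3 ∤ ord_p(4k)` ⇒ the cubic witness (`not_isUnramifiedAt_psi_of_not_three_dvd`); `p` odd with `s = 3` ⇒
`not_isUnramifiedAt_psi_of_ord_eq_three`; `p = 2`, `s = 1` ⇒ `…_two_of_ord_eq_one`; `p = 2`, `s = 4` ⇒ `k = 16u` with `u ≡ 3 (mod 4)` ⇒
`…_two_of_eq_sixteen_mul`.  Ireland–Rosen: «if `P ∣ 6D` then `χ(P) = 0`» — here as a theorem about the conductor of `ψ` (Silverman II
Thm. 9.2 (b): `ψ_{E/K}` ramifies exactly at the bad primes; `y² = x³ + k` is bad at every `p ∣ k`, `p ≥ 5`, and at `2` off the class `16(1+4ℤ)`).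
[cite: IrelandRosen1990, Ch. 18 §7] [cite: SilvermanATAEC1994, II Thm. 9.2 (b), Thm. 10.5] -/
theorem not_isUnramifiedAt_heckeOfGross_psi_of_ne_three {k : ℤ} (hk : k ≠ 0) (h6 : ∀ q : ℕ, q.Prime → ¬ (q : ℤ) ^ 6 ∣ k)
    (w₀ : InfinitePlace K) {p : ℕ} (hp : p.Prime) (hp3 : p ≠ 3) {w : HeightOneSpectrum (𝓞 K)}
    (hpw : (p : 𝓞 K) ∈ w.asIdeal) (hw : modulus k ≤ w.asIdeal) (hgood : p = 2 → ¬ ∃ u : ℤ, k = 16 * u ∧ u % 4 = 1) :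
    ¬ (heckeOfGross (modulus_ne_bot hk) (isGrossencharakter_psi_one_zero hζ hk w₀)).IsUnramifiedAt w := by
  haveI := Fact.mk hp
  obtain ⟨s, k₁, hks, hpk₁⟩ := int_exists_eq_pow_mul_not_dvd hk hp
  have hs6 : s < 6 := by
    by_contra h
    refine h6 p hp ⟨(p : ℤ) ^ (s - 6) * k₁, ?_⟩
    rw [hks, ← mul_assoc, ← pow_add, Nat.add_sub_cancel' (by omega)]
  by_cases hp2 : p = 2
  · subst hp2
    have h2w : (2 : 𝓞 K) ∈ w.asIdeal := by exact_mod_cast hpw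
    have hkm : 4 * k = ((2 : ℕ) : ℤ) ^ (s + 2) * k₁ := by rw [hks]; push_cast; ring
    interval_cases s
    · exact not_isUnramifiedAt_psi_of_not_three_dvd hζ hk w₀ (by norm_num) hkm hpk₁ (by norm_num) (by norm_num) hpw hw
    · exact not_isUnramifiedAt_psi_two_of_ord_eq_one hζ hk w₀ (m' := k₁) (by rw [hks]; ring) (by exact_mod_cast hpk₁) h2w hw
    · exact not_isUnramifiedAt_psi_of_not_three_dvd hζ hk w₀ (by norm_num) hkm hpk₁ (by norm_num) (by norm_num) hpw hw
    · exact not_isUnramifiedAt_psi_of_not_three_dvd hζ hk w₀ (by norm_num) hkm hpk₁ (by norm_num) (by norm_num) hpw hw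
    · have hk16 : k = 16 * k₁ := by rw [hks]; ring
      have hodd : ¬ (2 : ℤ) ∣ k₁ := by exact_mod_cast hpk₁
      have h43 : k₁ % 4 = 3 := by
        have h41 : k₁ % 4 ≠ 1 := fun h => hgood rfl ⟨k₁, hk16, h⟩
        omega
      exact not_isUnramifiedAt_psi_two_of_eq_sixteen_mul hζ hk w₀ hk16 h43 h2w hw
    · exact not_isUnramifiedAt_psi_of_not_three_dvd hζ hk w₀ (by norm_num) hkm hpk₁ (by norm_num) (by norm_num) hpw hw
  · -- `p` odd: `p ∣ k` since `6k ∈ 𝔭_w`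
    have hpZ : Prime (p : ℤ) := Nat.prime_iff_prime_int.mp hp
    have hs0 : s ≠ 0 := by
      rintro rfl
      rw [pow_zero, one_mul] at hks
      have h6k : ((6 * k : ℤ) : 𝓞 K) ∈ w.asIdeal := (modulus_le_iff k w).mp hw
      rcases hpZ.dvd_or_dvd ((intCast_mem_iff_dvd hp hpw (6 * k)).mp h6k) with h | h
      · rcases hpZ.dvd_or_dvd (show (p : ℤ) ∣ 2 * 3 by norm_num at h ⊢; exact h) with h' | h'
        · exact hp2 ((Nat.prime_dvd_prime_iff_eq hp Nat.prime_two).mp (by exact_mod_cast h'))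
        · exact hp3 ((Nat.prime_dvd_prime_iff_eq hp Nat.prime_three).mp (by exact_mod_cast h'))
      · exact hpk₁ (hks ▸ h)
    by_cases hs3 : s = 3
    · subst hs3
      exact not_isUnramifiedAt_psi_of_ord_eq_three hζ hk w₀ hp2 hp3 hks hpk₁ hpw hw
    · have hkm : 4 * k = (p : ℤ) ^ s * (4 * k₁) := by rw [hks]; ring
      have hs3' : ¬ 3 ∣ s := by omega
      exact not_isUnramifiedAt_psi_of_not_three_dvd hζ hk w₀ hp3 hkm (not_dvd_four_mul hp hp2 hpk₁) hs0 hs3' hpw hw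

end Two

end Literature.NumberTheory.GaloisRepresentations.EisensteinSextic

end
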